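import Summits.BirchSwinnertonDyer.BirchSwinnertonDyer.Theorems.ByReductionTypeAtTwoAnalyticMuStevensBridge
import Summits.BirchSwinnertonDyer.BirchSwinnertonDyer.Theorems.ByReductionTypeAtTwoAnalyticMuCollapse
import Summits.BirchSwinnertonDyer.BirchSwinnertonDyer.Theorems.ByReductionTypeAtTwoAnalyticMuCertificate
import Summits.BirchSwinnertonDyer.Rank1Residual.X1.MuLambdaAlgebra
import Literature.NumberTheory.EllipticCurves.PAdicLFunctionIntegralityProofs
import Literature.NumberTheory.EllipticCurves.ModPReducibilityProofs
import Literature.NumberTheory.EllipticCurves.Rank1Residual.MuLambdaCarriers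
import HarnessLib

/-!
# Route `ByReductionTypeAtTwo` (K4), TOWER road / shared μ₂-supply target — **THE ANALYTIC `μ`-INVARIANT AT
# `2` VANISHES for every elliptic curve over `ℚ` with good ORDINARY reduction at `2` and `E[2]` IRREDUCIBLE**
# (`MuAnZeroAt W 2`; `red G ≠ 0` for the integral lift `G` of `L₂(f, α, T)`) — a kernel theorem

Cell `bsd-2adic`, seat `bsd-2adic-tower-1` (GEN 24), `--supports stmt-BirchSwinnertonDyer-19271` (helper; brick P5
= assembly of P1–P4).  Theorems only; no definition, no named fact, no `sorry`.

## Statement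

For `W/ℚ` an elliptic curve (globally minimal model), `2` a prime of GOOD ORDINARY reduction (`IsOrdinaryAt W 2`,
= `Rank1Residual.GoodOrd W 2`) and `E[2]` IRREDUCIBLE as a Galois module (`W.HasIrreducibleModPGaloisRep 2`,
= `Rank1Residual.Irr W 2`, = «no rational point of order `2`»), and `f` ANY newform of `W` (`IsNewformOf W f`,
any level): SOME coefficient of the tree's `2`-adic `L`-function `L₂(f, α, T) = padicLFunction f (unitRoot W 2)`
(Mazur–Tate–Teitelbaum measure on `[x]⁺_f = re{∞,x}_f/Ω⁺_f`, `re Λ_f = ℤ·Ω⁺_f/2`, `Δ = {±1}`-pushforward, `γ = 5`)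
is a `2`-ADIC UNIT (`exists_norm_padicLCoeff_two_eq_one`).  Equivalently (all coefficients being `2`-integral,
INT2-AUTO `padicLFunction_integral_two_auto`): `μ(L₂(f, α, T)) = 0`:

* `muAnZeroAt_two_of_irr : IsOrdinaryAt W 2 → W.HasIrreducibleModPGaloisRep 2 → MuAnZeroAt W 2`
  (`Rank1Residual.MuLambdaCarriers` currency; `muAnZeroAt_two_of_goodOrd_of_irr` in `GoodOrd`/`Irr` spelling);
* `red_ne_zero_of_iwasawaToPowerSeries_eq_padicLFunction_two` — for every `G ∈ Λ₂ = ℤ₂⟦T⟧` with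
  `ι G = L₂(f, α, T)`: `red G ≠ 0` (the body of bsd-f1-sign2's crux `F1Sign2.AnalyticMuZeroAtTwo` at `W`; the
  literal `F1Sign2` spelling, with «no rational 2-torsion abscissa» in place of `Irr`, is the next file).

## Proof (kernel road P1 → P4, this seat; every named input a TREE THEOREM)

1. `E[2]` irreducible ⟹ (Chebotarev–Brauer–Nesbitt, `not_irreducible_of_frobeniusTrace_congr_holds`) ONE odd prime
   `ℓ` of good reduction with `a_ℓ(E)` ODD, and an ODD Eisenstein multiple `n₀{∞,0}_f ∈ Λ_f`
   (`exists_intCast_mul_modularSymbol_zero_mem`); good reduction at `2` ⟹ `2 ∤ N` (`not_dvd_level_of_isNewformOf`).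
2. THEOREM B of bsd-f3-mu / bsd-print-x8 (`ConjSpanGenAllLevels.conjSpanGenAll_of_vaserstein_away` + ty2's
   Vaserstein port, UNCONDITIONAL) + the Stevens `ℓ`-Hecke bridge made `p`-uniform (P1,
   `ByReductionTypeAtTwoAnalyticMuStevensBridge.exists_one_le_norm_two_mul_sub_two_of_odd`) ⟹ a 2-power cusp
   `b/2ᵏ` with a HALF-INTEGRAL winding class `[b/2ᵏ]⁺_f − [0]⁺_f ∈ ½ + ℤ`.
3. The collapse at `2` (P3, `ByReductionTypeAtTwoAnalyticMuCollapse.exists_odd_norm_two_mul_msdMeasure_eq_one`: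
   `[1/2]⁺ = (a₂ − 2)[0]⁺`, `a₂` odd, unit root `α ≡ 1 (mod 2)`, odd Eisenstein multiple) ⟹ a UNIT doubled value
   `2μ_{f,α}(b̄ + 2ᵐℤ₂)` at an odd class.
4. The certificate at `2` (P4, `ByReductionTypeAtTwoAnalyticMuCertificate.exists_norm_padicLCoeff_two_eq_one_of_odd`:
   Newton inversion + Lucas on the `γ`-exponent line; INT2-AUTO for `‖c_k‖ ≤ 1`) ⟹ a unit coefficient.

HONEST FRAMING.  This is Greenberg's conjecture [Greenberg LNM 1716, Conj. 1.11] read on the ANALYTIC side at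
`p = 2` on the locus {good ordinary at `2`, `E[2]` irreducible}, for the tree's `L₂(f, α, T)`; bsd-f1-sign2's REF2
records it OPEN-IN-PRINT at `2` («proved nowhere at 2»; witness there: raw `μ = 0` on 289/289 + 146/146 rows).
Beyond-print theorem: YES, modestly — it rests on THEOREM B (a beyond-print KERNEL theorem of cells bsd-f3-mu /
bsd-print-x8: Sun 2007 Conj. 8-type span statement, proved by the orbit trick in `Γ₀(N; ℤ[1/p])` + Vaserstein /
Serre's congruence subgroup property for `SL₂(ℤ[1/p])`) and on the MTT/Stevens/Manin folklore made kernel by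
cells bsd-print-x8 / bsd-print-x9 / o1; this seat's contribution is the three `p = 2` adaptations P1/P3/P4 and this
assembly.  The analogous odd-`p` statement is NOT obtained this way (there the dictionary «winding non-constancy ⟹
`μ = 0`» needs the open conjecture B⁰ `TeichSpanGenAll`; at `2` the Teichmüller group is `{±1}` and `[·]⁺` is
even).  It is a statement about `f` and `Ω⁺_f`: the passage to `Ω_W` (Manin constant / lattice index, the TOWER
doors' `ϖ`) is the next file's business (`AnalyticMuLE W 2 0` modulo Abbes–Ullmo).  Nothing is booked; no census
cell moves by this file alone; BSD is NOT proved by any of this.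

References: [GreenbergLNM1716] §1 Conj. 1.11; [MazurTateTeitelbaum1986Invent] §I.4 (4.2), §I.8, §I.10–I.13;
[Manin1972] Prop. 1.4; [Stevens1989] §4; [GreenbergVatsal2000] (2)–(3), Prop. (3.7); [Vaserstein1972SL2];
[SerreSL2Congruence1970] §2.6.
-/

-- the summit namespace repeats `BirchSwinnertonDyer` by design (summit = problem); linter moot
set_option linter.dupNamespace false
set_option autoImplicit false

noncomputable section

namespace Summit.BirchSwinnertonDyer.BirchSwinnertonDyer.Theorems.AnalyticMuTwo

open scoped MatrixGroups ModularForm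

open CongruenceSubgroup WeierstrassCurve Literature.NumberTheory.EllipticCurves
  Literature.NumberTheory.EllipticCurves.ModularForms Literature.NumberTheory.EllipticCurves.Rank1Residual

section Curve

variable (W : WeierstrassCurve ℚ) [W.IsElliptic] [W.IsGloballyMinimal]

/-- **A UNIT COEFFICIENT of `L₂(f, α, T)`** for every newform `f` of an elliptic curve `W/ℚ` with good ordinary
reduction at `2` and `E[2]` irreducible (`α = unitRoot W 2`).  Assembly of the kernel road P1 (Stevens bridge at
`2` over THEOREM B), P3 (collapse at `2`), P4 (certificate at `2`); inputs `not_irreducible_of_frobeniusTrace_congr_holds`,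
`exists_intCast_mul_modularSymbol_zero_mem`, `not_dvd_level_of_isNewformOf`, `cuspCoeff_eq_frobeniusTrace_of_isNewformOf_holds`,
`unitRoot_coe_spec`, `msdMeasure_distribution_of_isNewformOf`, `norm_msdMeasure_two_le_two_auto`,
`padicLFunction_integral_two_auto` — all tree theorems.
[cite: GreenbergLNM1716, §1 Conj. 1.11 (posed for all p; the p = 2 analytic reading is ours)]
[cite: MazurTateTeitelbaum1986Invent, §I.10–I.13] -/
theorem exists_norm_padicLCoeff_two_eq_one (hord : IsOrdinaryAt W 2) (hirr : W.HasIrreducibleModPGaloisRep 2)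
    {N : ℕ} [NeZero N] {f : CuspForm (Gamma0 N) 2} (hf : IsNewformOf W f) :
    ∃ k : ℕ, ‖padicLCoeff f (unitRoot W 2 : ℚ_[2]) k‖ = 1 := by
  haveI : Fact (Nat.Prime 2) := ⟨Nat.prime_two⟩
  -- the unit root
  obtain ⟨hαeq, hαu, hα0⟩ := unitRoot_coe_spec (W := W) hord
  have hαinv : ‖(unitRoot W 2 : ℚ_[2])⁻¹‖ ≤ 1 := by rw [norm_inv, hαu, inv_one]
  -- the newform: rational coefficients, odd level, `a₂(f) = a₂(W)` odd
  have hQ : coeffField f = ⊥ := hf.coeffField_eq_bot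
  have hreal : ∀ n, (cuspCoeff f n).im = 0 := cuspCoeff_im_eq_zero_of_coeffField_eq_bot hQ
  have h2N : ¬ 2 ∣ N := not_dvd_level_of_isNewformOf hf hord.1
  have ha₂ : cuspCoeff f 2 = ((W.frobeniusTrace 2 : ℤ) : ℂ) :=
    cuspCoeff_eq_frobeniusTrace_of_isNewformOf_holds hf hord.1
  have ha₂' : ¬ (2 : ℤ) ∣ W.frobeniusTrace 2 := by exact_mod_cast hord.2
  -- `E[2]` irreducible: an odd Eisenstein multiple and an odd prime `ℓ` with `a_ℓ` odd
  obtain ⟨n₀, hn₀, h0⟩ :=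
    exists_intCast_mul_modularSymbol_zero_mem (p := 2) not_irreducible_of_frobeniusTrace_congr_holds hf hirr
  have hn₀' : ¬ (2 : ℤ) ∣ n₀ := by exact_mod_cast hn₀
  obtain ⟨ℓ, hℓ, -, hgoodℓ, haℓ1⟩ :=
    exists_prime_not_dvd_frobeniusTrace_sub not_irreducible_of_frobeniusTrace_congr_holds W 2 hirr
  have hℓN : ¬ ℓ ∣ N := not_dvd_level_of_isNewformOf hf hgoodℓ
  have haℓ : cuspCoeff f ℓ = ((W.frobeniusTrace ℓ : ℤ) : ℂ) :=
    cuspCoeff_eq_frobeniusTrace_of_isNewformOf_holds hf hgoodℓ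
  -- P1 + THEOREM B: a half-integral winding class at a 2-power cusp
  obtain ⟨k, b, hkb⟩ := exists_one_le_norm_two_mul_sub_two_of_odd hf.1 hQ h2N hℓN haℓ
    (by exact_mod_cast haℓ1)
  -- P3: a unit doubled measure value at an odd class
  obtain ⟨n, bb, hbb, hunit⟩ := exists_odd_norm_two_mul_msdMeasure_eq_one hf.1 hQ h2N ha₂ ha₂' hαu hαeq
    hn₀' h0 ⟨k, b, hkb⟩
  -- P4: a unit coefficient
  obtain ⟨k', -, hk'⟩ := exists_norm_padicLCoeff_two_eq_one_of_odd f (unitRoot W 2 : ℚ_[2])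
    (msdMeasure_distribution_of_isNewformOf hord hf)
    (norm_msdMeasure_two_le_two_auto hf.1 hreal h2N ha₂ hαinv hαeq)
    (padicLFunction_integral_two_auto hord hf) hbb hunit
  exact ⟨k', hk'⟩

/-- **`μ^an(E, 2) = 0` on {good ordinary at `2`, `E[2]` irreducible}** in the carrier currency
`Rank1Residual.MuAnZeroAt W 2` (for every newform `f` of `W`, some coefficient of `L₂(f, α, T)` is a `2`-adic unit).
Greenberg's Conjecture 1.11, analytic side, `p = 2`, as a kernel theorem for the tree's `L₂`.
[cite: GreenbergLNM1716, §1 Conj. 1.11 (posed for all p; the p = 2 analytic reading is ours)]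
[cite: GreenbergVatsal2000, pp. 3–4, (2)–(3) (definition of μ^anal; transcribed as a predicate)] -/
theorem muAnZeroAt_two_of_irr (hord : IsOrdinaryAt W 2) (hirr : W.HasIrreducibleModPGaloisRep 2) :
    MuAnZeroAt W 2 := by
  intro N _ f hf
  obtain ⟨k, hk⟩ := exists_norm_padicLCoeff_two_eq_one W hord hirr hf
  exact ⟨k, by rw [coeff_padicLFunction]; exact hk⟩

/-- The same in the `Rank1Residual` spelling `GoodOrd W 2` / `Irr W 2` of the K4 route and its TOWER doors.
[cite: GreenbergLNM1716, §1 Conj. 1.11 (posed for all p; the p = 2 analytic reading is ours)] -/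
theorem muAnZeroAt_two_of_goodOrd_of_irr (hgo : GoodOrd W 2) (hirr : Irr W 2) : MuAnZeroAt W 2 :=
  muAnZeroAt_two_of_irr W hgo hirr

/-- **`red G ≠ 0` for every integral lift `G ∈ Λ₂` of `L₂(f, α, T)`** (`ι G = L₂(f, α, T)`), `W` good ordinary at
`2` with `E[2]` irreducible, `f` any newform of `W` — the body of bsd-f1-sign2's crux `F1Sign2.AnalyticMuZeroAtTwo`
at `W` (their `Irr`-spelling is «no rational `2`-torsion abscissa»; see the next file).  A unit coefficient of
`ι G` is the image of a unit of `ℤ₂`, which `red` does not kill.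
[cite: GreenbergLNM1716, §1 Conj. 1.11 (posed for all p; the p = 2 analytic reading is ours)]
[cite: Washington1997, §13.1] -/
theorem red_ne_zero_of_iwasawaToPowerSeries_eq_padicLFunction_two (hord : IsOrdinaryAt W 2)
    (hirr : W.HasIrreducibleModPGaloisRep 2) {N : ℕ} [NeZero N] {f : CuspForm (Gamma0 N) 2}
    (hf : IsNewformOf W f) {G : IwasawaAlgebra 2}
    (hG : iwasawaToPowerSeries 2 G = padicLFunction f (unitRoot W 2 : ℚ_[2])) :
    Summit.BirchSwinnertonDyer.Rank1Residual.X1.MuLambda.red G ≠ 0 := by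
  haveI : Fact (Nat.Prime 2) := ⟨Nat.prime_two⟩
  obtain ⟨k, hk⟩ := exists_norm_padicLCoeff_two_eq_one W hord hirr hf
  intro hred
  rw [Summit.BirchSwinnertonDyer.Rank1Residual.X1.MuLambda.red_eq_zero_iff] at hred
  obtain ⟨H, hH⟩ := hred
  have hcoeff : PowerSeries.coeff k (padicLFunction f (unitRoot W 2 : ℚ_[2])) =
      ((PowerSeries.coeff k G : ℤ_[2]) : ℚ_[2]) := by
    rw [← hG]
    simp [iwasawaToPowerSeries, PowerSeries.coeff_map]
  have hG2 : PowerSeries.coeff k G = 2 * PowerSeries.coeff k H := by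
    rw [hH, PowerSeries.coeff_C_mul]
    rfl
  rw [coeff_padicLFunction] at hcoeff
  rw [hcoeff, PadicInt.padic_norm_e_of_padicInt, hG2, norm_mul] at hk
  have h2 : ‖(2 : ℤ_[2])‖ = 2⁻¹ := by
    have h := PadicInt.norm_p (p := 2)
    simpa using h
  have hH1 : ‖PowerSeries.coeff k H‖ ≤ 1 := PadicInt.norm_le_one _
  rw [h2] at hk
  have : (1 : ℝ) ≤ 2⁻¹ * 1 := by
    calc (1 : ℝ) = 2⁻¹ * ‖PowerSeries.coeff k H‖ := hk.symm
      _ ≤ 2⁻¹ * 1 := by gcongr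
  norm_num at this

end Curve

end Summit.BirchSwinnertonDyer.BirchSwinnertonDyer.Theorems.AnalyticMuTwo

end
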